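import Summits.CriticalPhenomena.SAWScalingLimit.Theses.SAWReversalUpgrade
import Summits.CriticalPhenomena.SAWScalingLimit.Theorems.SAWDevelopingMapHexConjectureCurveUpgradeMain
import HarnessLib

/-!
# `stub_upgradeOfReturns` — the soft curve upgrade with returns (crux `PathUpgradeR`,
stmt-CriticalPhenomena-18055, route `SAWReversalUpgrade`, line `bidir_windows`)

Landing target:
`Summits/CriticalPhenomena/SAWScalingLimit/Theorems/SAWReversalUpgradePathUpgradeRUpgradeOfReturns.lean`
(`--supports stmt-CriticalPhenomena-18055`; registered stub `stub_upgradeOfReturns` of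
`Cruxes/PathUpgradeR/Lines/bidir_windows.lean`, statement verbatim).

**Theorem.** If `Γ` is a chordal SLE_{8/3} curve of the Dobrushin domain `D`, the classes of the
random curves `X δ ω` are eventually a.e.-measurable, their ranges converge in law (Hausdorff metric on
`NonemptyCompacts ℂ`) to the range of `Γ`, their endpoints are eventually exactly `a = D.pt 0`,
`b = D.pt 1`, and RETURNS DIE in law (`∀ ℓ η > 0 ∃ κ > 0`, eventually
`P δ {∃ s < u < t, ℓ ≤ |X s - X u| ∧ |X s - X t| ≤ κ} ≤ η`), then `X δ → SLE_{8/3}` in law in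
`CurveClass ℂ`.

**Proof.** The tree's curve upgrade
`Summit.CriticalPhenomena.SAWScalingLimit.Theorems.HexConjecture.RootLocality.Upgrade.curveUpgrade`
(range law + exact endpoints + "triple strands die" ⟹ convergence) applied to the modification `X'`
of `X` equal to the segment `[a, b]` at every mesh where some endpoint is wrong; `X' = X` eventually
along `𝓝[>] 0`, and every hypothesis and the conclusion only depend on that germ. Its triple-strand
hypothesis follows from "returns die": an `(ε, ℓ)`-triple strand of a representative `c` of the class
of `X δ ω` contains `s₀ < u < τ` with `|c s₀ - c u| > ℓ/3`, `|c s₀ - c τ| < 2ε`, and a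
reparametrisation `θ`-sup-close to `X δ ω` (the reparametrisation distance is an infimum and
`dist c (X δ ω) = 0`) turns it into an `(ℓ/4, κ)`-return of `X δ ω` for `ε = κ/4`,
`θ = min (κ/4) (ℓ/24)`. [folklore]
-/

noncomputable section

open scoped ENNReal NNReal Topology unitInterval
open MeasureTheory Filter Set Metric
open Literature.Probability.RandomPlanarGeometry

namespace Summit.CriticalPhenomena.SAWScalingLimit.Theorems

namespace PathUpgradeRUpgrade

/-! ### The segment curve and the representative transfer -/

/-- The straight segment from `a` to `b` as a curve. [folklore] -/
def segCurve (a b : ℂ) : Curve ℂ :=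
  ⟨⟨fun t => a + ((t : ℝ) : ℂ) * (b - a), by fun_prop⟩⟩

theorem segCurve_apply (a b : ℂ) (t : I) : segCurve a b t = a + ((t : ℝ) : ℂ) * (b - a) := rfl

theorem segCurve_source (a b : ℂ) : (segCurve a b).source = a := by
  simp [Curve.source_def, segCurve_apply]

theorem segCurve_target (a b : ℂ) : (segCurve a b).target = b := by
  simp [Curve.target_def, segCurve_apply]

/-- Two curves with the same class admit, for every `θ > 0`, an increasing reparametrisation of the
second that is pointwise `θ`-close to the first. [folklore] -/
theorem exists_reparam_of_mk_eq {c x : Curve ℂ} (h : CurveClass.mk c = CurveClass.mk x) {θ : ℝ}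
    (hθ : 0 < θ) : ∃ φ : I ≃o I, ∀ r : I, dist (c r) (x (φ r)) < θ := by
  have h0 : dist c x = 0 := CurveClass.mk_eq_mk_iff_dist_eq_zero.1 h
  obtain ⟨φ, hφ⟩ := Curve.exists_dist_reparam_lt (γ₁ := c) (γ₂ := x) (c := θ) (by rw [h0]; exact hθ)
  refine ⟨φ, fun r => ?_⟩
  have := ContinuousMap.dist_apply_le_dist (f := c.toContinuousMap) (g := (x.reparam φ).toContinuousMap) r
  exact lt_of_le_of_lt this hφ

/-- In a set of diameter `≥ ℓ > 0`, some point is more than `ℓ/3` away from any given point.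
[folklore] -/
theorem exists_dist_gt_of_le_diam {S : Set ℂ} {ℓ : ℝ} (hℓ : 0 < ℓ)
    (hdiam : ℓ ≤ diam S) (p : ℂ) : ∃ q ∈ S, ℓ / 3 < dist p q := by
  by_contra H
  push Not at H
  have hle : diam S ≤ 2 * (ℓ / 3) := by
    refine diam_le_of_forall_dist_le (by positivity) fun y hy z hz => ?_
    calc dist y z ≤ dist y p + dist p z := dist_triangle _ _ _
      _ = dist p y + dist p z := by rw [dist_comm y p]
      _ ≤ ℓ / 3 + ℓ / 3 := add_le_add (H y hy) (H z hz)
      _ = 2 * (ℓ / 3) := by ring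
  linarith

/-- **A triple strand of a representative contains a return of the curve.** If `mk c = mk x` and
`c` has three time-ordered sub-arcs of diameter `≥ ℓ > 0` pairwise within Hausdorff distance `ε > 0`,
then for every `θ > 0` the curve `x` has times `s < u < t` with `ℓ/3 - 2θ < |x s - x u|` and
`|x s - x t| < 2ε + 2θ`. [folklore] -/
theorem exists_return_of_tripleStrand {c x : Curve ℂ} (h : CurveClass.mk c = CurveClass.mk x)
    {ε ℓ θ : ℝ} (hε : 0 < ε) (hℓ : 0 < ℓ) (hθ : 0 < θ)
    (hs : ∃ s t : Fin 3 → I, (∀ i, s i ≤ t i) ∧ t 0 < s 1 ∧ t 1 < s 2 ∧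
      (∀ i, ℓ ≤ diam ((⇑c) '' Icc (s i) (t i))) ∧
      ∀ i j, hausdorffDist ((⇑c) '' Icc (s i) (t i)) ((⇑c) '' Icc (s j) (t j)) ≤ ε) :
    ∃ s u t : I, s < u ∧ u < t ∧ ℓ / 3 - 2 * θ < dist (x s) (x u) ∧
      dist (x s) (x t) < 2 * ε + 2 * θ := by
  obtain ⟨s, t, hst, h01, h12, hdiam, hhaus⟩ := hs
  -- the strands are nonempty bounded sets
  have hne : ∀ i, ((⇑c) '' Icc (s i) (t i)).Nonempty := fun i =>
    ⟨c (s i), mem_image_of_mem _ (left_mem_Icc.2 (hst i))⟩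
  have hbd : ∀ i, Bornology.IsBounded ((⇑c) '' Icc (s i) (t i)) := fun i =>
    ((isCompact_Icc.image c.continuous).isBounded)
  -- (a) a far point on strand 0
  obtain ⟨q, ⟨u, hu, rfl⟩, hfar⟩ := exists_dist_gt_of_le_diam hℓ (hdiam 0) (c (s 0))
  -- (b) a point of strand 1 near `c (s 0)`
  have hH : hausdorffDist ((⇑c) '' Icc (s 0) (t 0)) ((⇑c) '' Icc (s 1) (t 1)) < 2 * ε :=
    lt_of_le_of_lt (hhaus 0 1) (by linarith)
  obtain ⟨y, ⟨τ, hτ, rfl⟩, hnear⟩ := exists_dist_lt_of_hausdorffDist_lt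
    (mem_image_of_mem _ (left_mem_Icc.2 (hst 0))) hH
    (hausdorffEDist_ne_top_of_nonempty_of_bounded (hne 0) (hne 1) (hbd 0) (hbd 1))
  -- (c) order of the three times
  have hsu : s 0 < u := by
    rcases eq_or_lt_of_le hu.1 with h' | h'
    · exfalso
      rw [← h', dist_self] at hfar
      linarith
    · exact h'
  have huτ : u < τ := lt_of_le_of_lt hu.2 (lt_of_lt_of_le h01 hτ.1)
  -- (d) transfer to `x` along a `θ`-close reparametrisation
  obtain ⟨φ, hφ⟩ := exists_reparam_of_mk_eq h hθ
  refine ⟨φ (s 0), φ u, φ τ, φ.lt_iff_lt.2 hsu, φ.lt_iff_lt.2 huτ, ?_, ?_⟩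
  · have h1 := hφ (s 0)
    have h2 := hφ u
    have htri : dist (c (s 0)) (c u) ≤ dist (c (s 0)) (x (φ (s 0))) + dist (x (φ (s 0))) (x (φ u)) +
        dist (x (φ u)) (c u) := dist_triangle4 _ _ _ _
    rw [dist_comm (x (φ u)) (c u)] at htri
    linarith
  · have h1 := hφ (s 0)
    have h2 := hφ τ
    have htri : dist (x (φ (s 0))) (x (φ τ)) ≤ dist (x (φ (s 0))) (c (s 0)) + dist (c (s 0)) (c τ) +
        dist (c τ) (x (φ τ)) := dist_triangle4 _ _ _ _
    rw [dist_comm (x (φ (s 0))) (c (s 0))] at htri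
    linarith

end PathUpgradeRUpgrade

open PathUpgradeRUpgrade in
/-- **`stub_upgradeOfReturns`** (registered stub of the line `bidir_windows` for the crux `PathUpgradeR`,
stmt-CriticalPhenomena-18055; statement verbatim): the soft curve upgrade — SLE_{8/3} curve `Γ`,
eventual a.e.-measurability, range law, eventual exact endpoints and returns dying in law give
`ConvergesInLawToSLE (8/3) D (mk ∘ X) P`. Proof: `…HexConjecture.RootLocality.Upgrade.curveUpgrade` on
the endpoint-corrected modification `X'` (equal to `X` near `0⁺`), its triple-strand hypothesis being
supplied by `exists_return_of_tripleStrand` and monotonicity of measures. [folklore] -/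
theorem stub_upgradeOfReturns : ∀ (D : Literature.Probability.RandomPlanarGeometry.DobrushinDomain) (Ω : ℝ → Type) [∀ δ, MeasurableSpace (Ω δ)] (X : (δ : ℝ) → Ω δ → Literature.Probability.RandomPlanarGeometry.Curve ℂ) (P : (δ : ℝ) → MeasureTheory.Measure (Ω δ)) (Γ : (NNReal → ℝ) → Literature.Probability.RandomPlanarGeometry.CurveClass ℂ), Literature.Probability.RandomPlanarGeometry.IsSLECurve ((8:NNReal)/3) D Γ → (∀ᶠ δ in (nhdsWithin (0:ℝ) (Set.Ioi 0)), AEMeasurable (fun ω => Literature.Probability.RandomPlanarGeometry.CurveClass.mk (X δ ω)) (P δ)) → Literature.Probability.RandomPlanarGeometry.TendstoLaw (fun δ (ω : Ω δ) => (⟨⟨(Literature.Probability.RandomPlanarGeometry.CurveClass.mk (X δ ω)).range, (Literature.Probability.RandomPlanarGeometry.CurveClass.mk (X δ ω)).isCompact_range⟩, (Literature.Probability.RandomPlanarGeometry.CurveClass.mk (X δ ω)).range_nonempty⟩ : TopologicalSpace.NonemptyCompacts ℂ)) P (fun ω => (⟨⟨(Γ ω).range, (Γ ω).isCompact_range⟩,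 (Γ ω).range_nonempty⟩ : TopologicalSpace.NonemptyCompacts ℂ)) Literature.Probability.Process.preWienerMeasure → (∀ᶠ δ in (nhdsWithin (0:ℝ) (Set.Ioi 0)), ∀ ω : Ω δ, (X δ ω).source = D.pt 0 ∧ (X δ ω).target = D.pt 1) → (∀ ℓ : ℝ, 0 < ℓ → ∀ η : ℝ, 0 < η → ∃ κ : ℝ, 0 < κ ∧ ∀ᶠ δ in (nhdsWithin (0:ℝ) (Set.Ioi 0)), P δ {ω | ∃ s u t : unitInterval, s < u ∧ u < t ∧ ℓ ≤ dist (X δ ω s) (X δ ω u) ∧ dist (X δ ω s) (X δ ω t) ≤ κ} ≤ ENNReal.ofReal η) → Literature.Probability.RandomPlanarGeometry.ConvergesInLawToSLE ((8:NNReal)/3) D (fun δ (ω : Ω δ) => Literature.Probability.RandomPlanarGeometry.CurveClass.mk (X δ ω)) P := by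
  intro D Ω _ X P Γ hΓ hmeas hrange hend hret
  classical
  -- the endpoint-corrected modification
  let X' : (δ : ℝ) → Ω δ → Curve ℂ := fun δ ω =>
    if (∀ ω : Ω δ, (X δ ω).source = D.pt 0 ∧ (X δ ω).target = D.pt 1) then X δ ω
    else segCurve (D.pt 0) (D.pt 1)
  have hXX' : ∀ᶠ δ in 𝓝[>] (0 : ℝ), ∀ ω, X' δ ω = X δ ω := by
    filter_upwards [hend] with δ hδ ω
    simp only [X', if_pos hδ]
  have hsrc : ∀ δ ω, (CurveClass.mk (X' δ ω)).source = (fun _ : ℝ => D.pt 0) δ := by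
    intro δ ω
    simp only [CurveClass.source_mk, X']
    split_ifs with h
    · exact (h ω).1
    · exact segCurve_source _ _
  have htgt : ∀ δ ω, (CurveClass.mk (X' δ ω)).target = (fun _ : ℝ => D.pt 1) δ := by
    intro δ ω
    simp only [CurveClass.target_mk, X']
    split_ifs with h
    · exact (h ω).2
    · exact segCurve_target _ _
  have hmeas' : ∀ᶠ δ in 𝓝[>] (0 : ℝ), AEMeasurable (fun ω => CurveClass.mk (X' δ ω)) (P δ) := by
    filter_upwards [hmeas, hXX'] with δ h1 h2
    have : (fun ω => CurveClass.mk (X' δ ω)) = fun ω => CurveClass.mk (X δ ω) :=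
      funext fun ω => by rw [h2 ω]
    rw [this]
    exact h1
  have hrange' : TendstoLaw (fun δ (ω : Ω δ) => (⟨⟨(CurveClass.mk (X' δ ω)).range,
      (CurveClass.mk (X' δ ω)).isCompact_range⟩, (CurveClass.mk (X' δ ω)).range_nonempty⟩ :
        TopologicalSpace.NonemptyCompacts ℂ)) P
      (fun ω => (⟨⟨(Γ ω).range, (Γ ω).isCompact_range⟩, (Γ ω).range_nonempty⟩ :
        TopologicalSpace.NonemptyCompacts ℂ)) Literature.Probability.Process.preWienerMeasure := by
    intro f
    refine (hrange f).congr' ?_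
    filter_upwards [hXX'] with δ h2
    have : (fun ω => f (⟨⟨(CurveClass.mk (X' δ ω)).range, (CurveClass.mk (X' δ ω)).isCompact_range⟩,
        (CurveClass.mk (X' δ ω)).range_nonempty⟩ : TopologicalSpace.NonemptyCompacts ℂ)) =
        fun ω => f (⟨⟨(CurveClass.mk (X δ ω)).range, (CurveClass.mk (X δ ω)).isCompact_range⟩,
        (CurveClass.mk (X δ ω)).range_nonempty⟩ : TopologicalSpace.NonemptyCompacts ℂ) := by
      funext ω
      simp only [h2 ω]
    rw [this]
  -- triple strands of `X'` die: they contain returns of `X`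
  have htriple : ∀ ℓ : ℝ, 0 < ℓ → ∀ η : ℝ, 0 < η → ∃ ε : ℝ, 0 < ε ∧ ∀ᶠ δ : ℝ in 𝓝[>] (0 : ℝ),
      P δ {ω | ∃ c : Curve ℂ, CurveClass.mk c = CurveClass.mk (X' δ ω) ∧
        ∃ s t : Fin 3 → I, (∀ i, s i ≤ t i) ∧ t 0 < s 1 ∧ t 1 < s 2 ∧
          (∀ i, ℓ ≤ diam ((⇑c) '' Icc (s i) (t i))) ∧
          ∀ i j, hausdorffDist ((⇑c) '' Icc (s i) (t i)) ((⇑c) '' Icc (s j) (t j)) ≤ ε} ≤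
        ENNReal.ofReal η := by
    intro ℓ hℓ η hη
    obtain ⟨κ, hκ, hev⟩ := hret (ℓ / 4) (by positivity) η hη
    refine ⟨κ / 4, by positivity, ?_⟩
    filter_upwards [hev, hXX'] with δ hδ h2
    refine le_trans (measure_mono ?_) hδ
    rintro ω ⟨c, hc, hs⟩
    rw [h2 ω] at hc
    have hθ : 0 < min (κ / 4) (ℓ / 24) := lt_min (by positivity) (by positivity)
    obtain ⟨s, u, t, hsu, hut, hfar, hnear⟩ :=
      exists_return_of_tripleStrand hc (by positivity) hℓ hθ hs
    have hm1 : min (κ / 4) (ℓ / 24) ≤ κ / 4 := min_le_left _ _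
    have hm2 : min (κ / 4) (ℓ / 24) ≤ ℓ / 24 := min_le_right _ _
    refine ⟨s, u, t, hsu, hut, ?_, ?_⟩
    · linarith
    · linarith
  -- the curve upgrade for `X'`
  have hconv' := HexConjecture.RootLocality.Upgrade.curveUpgrade D Ω (fun δ ω => CurveClass.mk (X' δ ω))
    P Γ (fun _ => D.pt 0) (fun _ => D.pt 1) hΓ hmeas' hrange' hsrc htgt tendsto_const_nhds
    tendsto_const_nhds htriple
  -- back to `X`
  obtain ⟨Γ', hΓ', -, hTL⟩ := hconv'
  refine ⟨Γ', hΓ', hmeas, fun f => (hTL f).congr' ?_⟩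
  filter_upwards [hXX'] with δ h2
  have : (fun ω => f (CurveClass.mk (X' δ ω))) = fun ω => f (CurveClass.mk (X δ ω)) :=
    funext fun ω => by rw [h2 ω]
  rw [this]

end Summit.CriticalPhenomena.SAWScalingLimit.Theorems

end
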